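/-
Copyright (c) 2026 the pub-hodgecm-mathlib formalisation cell (harness21).  Prover seat hodgecm-mathlib-K2E1-p10 (g2), Track B ∕ K2-LIT (build stream 29), h413 = `stmt-HodgeConjecture-24833`,
route of record `HCCMUnconditional`, ROADCARD «5Res ENDGAME BY FAMILIES» §2 C7; dealer K2E1-plan (g7) (252) — THE LETTER-FREE C7 PRINTS: every brick is ★ (F1∕F2a∕F2b∕F3a∕F3b∕F3b′∕F3c∕P1a∕P1b∕
F3d-α∕β∕γ∕δ∕ε, the world bridge), so `E^{K′} ⊆ closure Σ_χ Θ_χ^{K′}` holds for the CM pair with NO hypothesis beyond the structural data of the level `K′`.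
-/
import Summits.HodgeConjecture.HodgeConjecture.Theorems.K2E1PseudoEisensteinFamilyDecompositionU2OfDelta     -- ★ (this seat, p860460): the all-`χ` print modulo `hα`
import Summits.HodgeConjecture.HodgeConjecture.Theorems.K2E1PseudoEisensteinFamilyDecompositionFiniteU2      -- ★∕📤 (this seat, p860626): the finite-index print modulo `hα`
import Summits.HodgeConjecture.HodgeConjecture.Theorems.K2E1NormOneTorusFamilyApproxU2                   -- ★ F3d-α (K2E1-p12, p860579): `exists_finset_heckeCharacter_family_decomposition` = `hα`
import HarnessLib

/-!
# h413 ∕ Track B «K2-LIT», ROADCARD «5Res BY FAMILIES» §2 C7 — `K2E1PseudoEisensteinFamilyDecompositionU2OfBricks`: **THE LETTER-FREE C7 THEOREMS** for `U(1,1)_{L∕L⁺}` at an open compact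
# level `K′`: `(L²_cusp)ᗮ ∩ L²(X)^{K′} ⊆ closure ⨆_{χ} span { [quotFun (E (f(H)·φ))] : f ∈ C_c((0,∞)), φ ∈ chiSectionSpace χ K′ 1 }`, over ALL ray-indexed `χ` (§1) and over the FINITE
# level-`K′` family index `S(K′)` of ★ F3d-ε (§2) — `hα` := ★ F3d-α `exists_finset_heckeCharacter_family_decomposition hc hBK` (K2E1-p12)

Cell `pub/hodgecm-mathlib`, crux h413 = `stmt-HodgeConjecture-24833`, route of record `HCCMUnconditional`; dealer K2E1-plan (g7) (252).  THEOREMS ONLY; lane `--supports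
stmt-HodgeConjecture-24833 --as helper` (count-neutral).  Closes no socket.  Remaining hypotheses are STRUCTURAL ONLY: `μ` automorphic, a Haar `ν` on `G(𝔸)`, `K′` open compact with
`H` right-`K′`-invariant, finitely many `(B(𝔸),K′)`-double cosets (`hBK` ∕ explicit representatives `W`), a bi-invariant inversion-invariant probability `μK` on `K′`.

* §1 **`cuspidal_orthogonal_inf_invariants_le_topologicalClosure_iSup_family_of_bricks`** (all `χ`).
* §2 **`cuspidal_orthogonal_inf_invariants_le_topologicalClosure_biSup_levelFamilies_of_bricks`** (finite `S(K′)`; K2E4-p14's `β` for the (EXH)∕atoms glue).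

HONEST LABEL: HC_CM is proved only modulo the 7 printed citations (2 remaining named inputs: hLiu418 = `stmt-HodgeConjecture-24832`, h413 = `stmt-HodgeConjecture-24833`) until rung 0
closes; this file asserts no named fact and closes no socket.
References: [MoeglinWaldspurger1995] C. Mœglin, J.-L. Waldspurger, *Spectral Decomposition and Eisenstein Series*, II.1.1–II.1.4, II.2.4; [BernsteinLapid2019] J. Bernstein, E. Lapid, *On the
meromorphic continuation of Eisenstein series*, §4.
-/

set_option autoImplicit false
set_option linter.dupNamespace false  -- the mandated namespace repeats the summit's segment (`HodgeConjecture.HodgeConjecture`)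

noncomputable section

open MeasureTheory Measure Set Filter Topology NumberField
open Literature.MeasureTheory.Group Literature.NumberTheory.Automorphic Literature.NumberTheory.Automorphic.UnitaryGroup Literature.NumberTheory.GaloisRepresentations AdelicGroupData ContRepresentation
open Summit.HodgeConjecture.HodgeConjecture.Cruxes.H413.K2E1BorelEisensteinU
open Summit.HodgeConjecture.HodgeConjecture.Cruxes.H413.K2E1CharacterEisensteinU2Defs
open Summit.HodgeConjecture.HodgeConjecture.Cruxes.H413.K2E1ChiSectionSpaceU2Defs
open Summit.HodgeConjecture.HodgeConjecture.Cruxes.H413.K2E1PseudoEisensteinFamilyDecompositionU2OfDelta (cuspidal_orthogonal_inf_invariants_le_topologicalClosure_iSup_family)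
open Summit.HodgeConjecture.HodgeConjecture.Cruxes.H413.K2E1PseudoEisensteinFamilyDecompositionFiniteU2 (cuspidal_orthogonal_inf_invariants_le_topologicalClosure_biSup_levelFamilies)
open Summit.HodgeConjecture.HodgeConjecture.Cruxes.H413.K2E1NormOneTorusFamilyApproxU2 (exists_finset_heckeCharacter_family_decomposition)
open scoped ENNReal NNReal Pointwise

namespace Summit.HodgeConjecture.HodgeConjecture.Cruxes.H413.K2E1PseudoEisensteinFamilyDecompositionU2OfBricks

variable (L : Type) [Field L] [NumberField L] [IsCMField L]
  [MeasurableSpace (quasiSplit (↥(maximalRealSubfield L)) L (IsCMField.complexConj L) 2).Adelic] [BorelSpace (quasiSplit (↥(maximalRealSubfield L)) L (IsCMField.complexConj L) 2).Adelic]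
  (μ : Measure (quasiSplit (↥(maximalRealSubfield L)) L (IsCMField.complexConj L) 2).automorphicQuotient) [(quasiSplit (↥(maximalRealSubfield L)) L (IsCMField.complexConj L) 2).IsAutomorphicMeasure μ]

/-! ## §1 All families -/

/-- **C7, LETTER-FREE, ALL FAMILIES**: `(L²_cusp)ᗮ ∩ L²(X)^{K′} ⊆ closure ⨆_{χ : HeckeCharacter L} span { [quotFun (E (f(H)·φ))] : f ∈ C_c((0,∞)), φ ∈ chiSectionSpace χ K′ 1 }` for the CM pair (★
OfDelta with `hα :=` ★ F3d-α). [cite: MoeglinWaldspurger1995, II.1.1–II.1.4, II.2.4] [cite: BernsteinLapid2019, §4] -/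
theorem cuspidal_orthogonal_inf_invariants_le_topologicalClosure_iSup_family_of_bricks (hc : IsCMField.complexConj L * IsCMField.complexConj L = 1)
    (ν : Measure (quasiSplit (↥(maximalRealSubfield L)) L (IsCMField.complexConj L) 2).Adelic) [ν.IsHaarMeasure]
    (K' : Subgroup (quasiSplit (↥(maximalRealSubfield L)) L (IsCMField.complexConj L) 2).Adelic) (hK'o : IsOpen (K' : Set (quasiSplit (↥(maximalRealSubfield L)) L (IsCMField.complexConj L) 2).Adelic))
    (hK'c : IsCompact (K' : Set (quasiSplit (↥(maximalRealSubfield L)) L (IsCMField.complexConj L) 2).Adelic))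
    (hHK' : ∀ (g k : (quasiSplit (↥(maximalRealSubfield L)) L (IsCMField.complexConj L) 2).Adelic), k ∈ K' → borelHeight (g * k) = borelHeight g)
    (hBK : ∃ W : Finset (quasiSplit (↥(maximalRealSubfield L)) L (IsCMField.complexConj L) 2).Adelic, ∀ g, ∃ β ∈ borelAdelic (↥(maximalRealSubfield L)) L (IsCMField.complexConj L) 2, ∃ w ∈ W, ∃ k ∈ K', g = β * w * k)
    (μK : Measure ↥K') [IsProbabilityMeasure μK] [μK.IsMulLeftInvariant] [μK.IsMulRightInvariant] [μK.IsInvInvariant] :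
    ∃ 𝔓 : (quasiSplit (↥(maximalRealSubfield L)) L (IsCMField.complexConj L) 2).ParabolicUnipotentData,
      (∀ i : 𝔓.ι, 𝔓.radical i = adelicUnipotent (↥(maximalRealSubfield L)) L (IsCMField.complexConj L) 2) ∧
      ((quasiSplit (↥(maximalRealSubfield L)) L (IsCMField.complexConj L) 2).cuspidalSubspace μ 𝔓).toSubmoduleᗮ ⊓
          (((quasiSplit (↥(maximalRealSubfield L)) L (IsCMField.complexConj L) 2).rightRegular μ).restrict K'.subtype).invariants ≤
      (⨆ χ : HeckeCharacter L, Submodule.span ℂ {v : (quasiSplit (↥(maximalRealSubfield L)) L (IsCMField.complexConj L) 2).L2 μ |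
        ∃ (f : ℝ → ℂ) (_ : Continuous f) (_ : HasCompactSupport f) (_ : tsupport f ⊆ Ioi 0)
          (φ : (quasiSplit (↥(maximalRealSubfield L)) L (IsCMField.complexConj L) 2).Adelic → ℂ) (_ : φ ∈ chiSectionSpace χ K' 1) (_ : Continuous φ)
          (hv : MemLp ((quasiSplit (↥(maximalRealSubfield L)) L (IsCMField.complexConj L) 2).quotFun (eisensteinSeriesU (fun g => f (borelHeight g) * φ g))) 2 μ), v = hv.toLp _}).topologicalClosure :=
  cuspidal_orthogonal_inf_invariants_le_topologicalClosure_iSup_family L μ hc ν K' hK'o hK'c hHK' hBK μK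
    @fun ψ hψc hψU hψB hψK _ _ ha hband ε hε => exists_finset_heckeCharacter_family_decomposition hc hBK ψ hψc hψU hψB hψK ha hband ε hε

/-! ## §2 The finite level-`K′` family index -/

/-- **C7, LETTER-FREE, FINITE INDEX**: `(L²_cusp)ᗮ ∩ L²(X)^{K′} ⊆ closure ⨆_{χ ∈ S(K′)} span { [quotFun (E (f(H)·φ))] }` with the FINITE `S(K′) = {χ | χ(r_∞) = 1 ∧ ∃ w ∈ W, χ|_{U_w} = 1}`
(★ `finite_setOf_rayTrivial_levelTrivial`) — the exhaustion input of the (EXH)∕atoms glue (★ `K2E1FamilyExhaustionInjectiveU`, K2E4-p14). [cite: MoeglinWaldspurger1995, II.1.1–II.1.4, II.2.4] -/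
theorem cuspidal_orthogonal_inf_invariants_le_topologicalClosure_biSup_levelFamilies_of_bricks (hc : IsCMField.complexConj L * IsCMField.complexConj L = 1)
    (ν : Measure (quasiSplit (↥(maximalRealSubfield L)) L (IsCMField.complexConj L) 2).Adelic) [ν.IsHaarMeasure]
    (K' : Subgroup (quasiSplit (↥(maximalRealSubfield L)) L (IsCMField.complexConj L) 2).Adelic) (hK'o : IsOpen (K' : Set (quasiSplit (↥(maximalRealSubfield L)) L (IsCMField.complexConj L) 2).Adelic))
    (hK'c : IsCompact (K' : Set (quasiSplit (↥(maximalRealSubfield L)) L (IsCMField.complexConj L) 2).Adelic))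
    (hHK' : ∀ (g k : (quasiSplit (↥(maximalRealSubfield L)) L (IsCMField.complexConj L) 2).Adelic), k ∈ K' → borelHeight (g * k) = borelHeight g)
    (W : Finset (quasiSplit (↥(maximalRealSubfield L)) L (IsCMField.complexConj L) 2).Adelic) (hW : ∀ g, ∃ β ∈ borelAdelic (↥(maximalRealSubfield L)) L (IsCMField.complexConj L) 2, ∃ w ∈ W, ∃ k ∈ K', g = β * w * k)
    (μK : Measure ↥K') [IsProbabilityMeasure μK] [μK.IsMulLeftInvariant] [μK.IsMulRightInvariant] [μK.IsInvInvariant] :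
    ∃ 𝔓 : (quasiSplit (↥(maximalRealSubfield L)) L (IsCMField.complexConj L) 2).ParabolicUnipotentData,
      (∀ i : 𝔓.ι, 𝔓.radical i = adelicUnipotent (↥(maximalRealSubfield L)) L (IsCMField.complexConj L) 2) ∧
      ((quasiSplit (↥(maximalRealSubfield L)) L (IsCMField.complexConj L) 2).cuspidalSubspace μ 𝔓).toSubmoduleᗮ ⊓
          (((quasiSplit (↥(maximalRealSubfield L)) L (IsCMField.complexConj L) 2).rightRegular μ).restrict K'.subtype).invariants ≤
      (⨆ χ ∈ {χ : HeckeCharacter L | (∀ r : ℝ≥0ˣ, χ (posRealIdele L r) = 1) ∧ ∃ w ∈ W, ∀ u ∈ ((K'.map (MulAut.conj w).toMonoidHom).comap ((borelAdelic (↥(maximalRealSubfield L)) L (IsCMField.complexConj L) 2).subtype.comp (torusInBorel (↥(maximalRealSubfield L)) L (IsCMField.complexConj L) 2).subtype)).map (MonoidHom.mk' (fun t : torusInBorel (↥(maximalRealSubfield L)) L (IsCMField.complexConj L) 2 => diagUnit (t : borelAdelic (↥(maximalRealSubfield L)) L (IsCMField.complexConj L) 2).2 0) (fun t t' => diagUnit_torus_mul_two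 t t' 0)), χ u = 1}, Submodule.span ℂ {v : (quasiSplit (↥(maximalRealSubfield L)) L (IsCMField.complexConj L) 2).L2 μ |
        ∃ (f : ℝ → ℂ) (_ : Continuous f) (_ : HasCompactSupport f) (_ : tsupport f ⊆ Ioi 0)
          (φ : (quasiSplit (↥(maximalRealSubfield L)) L (IsCMField.complexConj L) 2).Adelic → ℂ) (_ : φ ∈ chiSectionSpace χ K' 1) (_ : Continuous φ)
          (hv : MemLp ((quasiSplit (↥(maximalRealSubfield L)) L (IsCMField.complexConj L) 2).quotFun (eisensteinSeriesU (fun g => f (borelHeight g) * φ g))) 2 μ), v = hv.toLp _}).topologicalClosure :=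
  cuspidal_orthogonal_inf_invariants_le_topologicalClosure_biSup_levelFamilies L μ hc ν K' hK'o hK'c hHK' W hW μK
    @fun ψ hψc hψU hψB hψK _ _ ha hband ε hε => exists_finset_heckeCharacter_family_decomposition hc ⟨W, hW⟩ ψ hψc hψU hψB hψK ha hband ε hε

end Summit.HodgeConjecture.HodgeConjecture.Cruxes.H413.K2E1PseudoEisensteinFamilyDecompositionU2OfBricks

end
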